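import Summits.HubbardSuperconductivity.HubbardSuperconductivity.Theses.ColourTheSpin
import Summits.HubbardSuperconductivity.HubbardSuperconductivity.Theorems.SgAnchorOrder.Negative.Freezing

/-!
# Route `ColourTheSpin`, crux item `SgCorridor` (stmt-HubbardSuperconductivity-16274)

`SgCorridor := SgAnchorOrder → SgCorridorOrder` is an implication between two INDEPENDENT existential
route items, hence propositionally `¬ SgAnchorOrder ∨ SgCorridorOrder`. It holds — VACUOUSLY — because
its hypothesis `SgAnchorOrder` (one constant `c > 0` of gauged `B₁g` pair order for ALL gauge couplings
`g ≥ g₀`) is false by STRONG-COUPLING LINK FREEZING: at a fixed even side `L` with `c L² > 33`, as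
`g → ∞` every ground state of the `N_L`-block of the `Q₈`-spin-gauged torus `H_g(L,U)` concentrates on
the electric vacuum, and the transported bond pair field multiplies every link by a factor of zero
`Q₈`-mean, so `⟨ψ, Δ_d^g†Δ_d^g ψ⟩ ≤ 33 L² ‖ψ‖² < c L⁴ ‖ψ‖²` for `g ≥ G(L,U)`.

The two analytic inputs are the ACCEPTED negative-lane lemmas
`ColourTheSpinSgAnchorOrderRefutation.ceiling_lit` (the `O(L²)` pair ceiling at the frozen end) and
`ColourTheSpinSgAnchorOrderRefutation.gs_lit` (a normalised block ground state exists) of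
`Theorems/SgAnchorOrder/Negative/Freezing.lean`; they are exactly the two registered stubs
`stub_pairCeiling` / `stub_groundStateExists` of the line `Cruxes/SgCorridor/Lines/anchor_vacuity.lean`,
transported along the definitional identities `spinGaugedHubbardTorus_eq_inline`,
`spinGaugedPairField_eq_inline` (the route's inlined `let` block IS the Literature model). The
composition script of `sgAnchorOrder_false` is adapted from `Cruxes/SgAnchorOrder/Disproof.lean` §1
(refuter-cdisprove-stmt-HubbardSuperconductivity-16273-0) and `Lines/anchor_vacuity.lean` §4
(planner-cstrat-stmt-HubbardSuperconductivity-16274-b1-0).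

WHAT THIS FILE IS NOT: progress toward the summit. It settles the crux AS TYPED; the intended corridor
transfer has no object to act on once the anchor is empty (route kill criterion `refuted:SgAnchorOrder`).

Sources: J. Kogut, L. Susskind, PRD 11 (1975) 395; S. Elitzur, PRD 12 (1975) 3978; E. Fradkin,
S. Shenker, PRD 19 (1979) 3682. [folklore]
-/

namespace Summit.HubbardSuperconductivity.ColourTheSpin

open Literature.MathematicalPhysics.QuantumLattice
open Summit.HubbardSuperconductivity.HubbardSuperconductivity.Theses.ColourTheSpin
open Summit.HubbardSuperconductivity.HubbardSuperconductivity.Theorems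
open scoped Matrix

/-- **The hypothesis of the crux is uninhabited: `¬ SgAnchorOrder`** (strong-coupling link freezing).
Given `(U, δ, g₀, c, L₀)`, take an even `L ≥ L₀` with `c L² > 33` and `g = max g₀ G(L,U)`; a normalised
ground state of the `N_L`-block exists (`gs_lit`) and has `⟨Δ_d^g†Δ_d^g⟩ ≤ 33 L²` (`ceiling_lit`),
against the anchor's `≥ c L⁴ > 33 L²`. The route text is matched with the Literature constants
`spinGaugedHubbardTorus` / `spinGaugedPairField` / the block predicate by definitional unfolding
(`spinGaugedHubbardTorus_eq_inline`, `spinGaugedPairField_eq_inline`). Script adapted from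
`Cruxes/SgAnchorOrder/Disproof.lean` §1. [folklore] -/
theorem sgAnchorOrder_false : ¬ SgAnchorOrder := by
  intro hAnchor
  obtain ⟨U, hU, δ, hδ, g₀, hg₀, c, hc, L₀, hcrux⟩ := hAnchor
  obtain ⟨n, hn⟩ := exists_nat_gt (33 / c)
  obtain ⟨L, hL0, hLn, hLeven, hLpos⟩ : ∃ L : ℕ, L₀ ≤ L ∧ n < L ∧ Even L ∧ 0 < L :=
    ⟨2 * (n + L₀ + 1), by omega, by omega, ⟨n + L₀ + 1, by ring⟩, by omega⟩
  haveI : NeZero L := ⟨Nat.pos_iff_ne_zero.mp hLpos⟩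
  have hL2pos : (0 : ℝ) < (L : ℝ) ^ 2 := by positivity
  have hAL : 33 < c * (L : ℝ) ^ 2 := by
    have h1 : (n : ℝ) < (L : ℝ) := by exact_mod_cast hLn
    have hL1 : (1 : ℝ) ≤ (L : ℝ) := by exact_mod_cast hLpos
    have h2 : (L : ℝ) ≤ (L : ℝ) ^ 2 := by nlinarith
    have h3 : 33 / c < (L : ℝ) ^ 2 := lt_of_lt_of_le (hn.trans h1) h2
    have h4 : 33 < (L : ℝ) ^ 2 * c := (div_lt_iff₀ hc).mp h3
    linarith [mul_comm ((L : ℝ) ^ 2) c]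
  obtain ⟨G, hG⟩ := ColourTheSpinSgAnchorOrderRefutation.ceiling_lit L U δ hδ
  have hcr := hcrux (max g₀ G) (le_max_left g₀ G) L hL0 hLeven
  obtain ⟨ψ, hnorm, hGS⟩ := ColourTheSpinSgAnchorOrderRefutation.gs_lit L U δ (max g₀ G) hδ
    (fun ik : SpinGauged.Index L Q8 => ik.1.card = 2 * ⌊(1 - δ) * (L : ℝ) ^ 2 / 2⌋₊)
    (instD := inferInstance) rfl
  have h1 : c * (L : ℝ) ^ 4 * (star ψ ⬝ᵥ ψ).re ≤
      (star ψ ⬝ᵥ ((spinGaugedPairField L)ᴴ * spinGaugedPairField L).toBlock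
        (fun ik : SpinGauged.Index L Q8 => ik.1.card = 2 * ⌊(1 - δ) * (L : ℝ) ^ 2 / 2⌋₊)
        (fun ik : SpinGauged.Index L Q8 => ik.1.card = 2 * ⌊(1 - δ) * (L : ℝ) ^ 2 / 2⌋₊) *ᵥ ψ).re :=
    hcr ψ hGS
  have h2 := hG (max g₀ G) (le_max_right g₀ G)
    (fun ik : SpinGauged.Index L Q8 => ik.1.card = 2 * ⌊(1 - δ) * (L : ℝ) ^ 2 / 2⌋₊)
    (instD := inferInstance) rfl ψ hGS
  have hn1 : (star ψ ⬝ᵥ ψ).re = 1 := by rw [hnorm]; simp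
  have h3 : c * (L : ℝ) ^ 4 * (star ψ ⬝ᵥ ψ).re ≤ 33 * (L : ℝ) ^ 2 * (star ψ ⬝ᵥ ψ).re :=
    le_trans h1 h2
  rw [hn1, mul_one, mul_one] at h3
  have h4 : 33 * (L : ℝ) ^ 2 < c * (L : ℝ) ^ 2 * (L : ℝ) ^ 2 := mul_lt_mul_of_pos_right hAL hL2pos
  have h5 : c * (L : ℝ) ^ 4 = c * (L : ℝ) ^ 2 * (L : ℝ) ^ 2 := by ring
  linarith

/-- **Route item `SgCorridor`** (`SgAnchorOrder → SgCorridorOrder`), proved — vacuously: the hypothesis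
is uninhabited (`sgAnchorOrder_false`), ex falso quodlibet. [folklore] -/
theorem sgCorridor_proof :
    Summit.HubbardSuperconductivity.HubbardSuperconductivity.Theses.ColourTheSpin.SgCorridor :=
  fun hA => (sgAnchorOrder_false hA).elim

end Summit.HubbardSuperconductivity.ColourTheSpin
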